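/-
Origin: expansion seat `planner-pub-hodgecm-pv12-0`, handover 2026-08-18T03:27:30Z (`HOME/pub-hodgecm-pv12/lean/HodgeCM/PerL34/CharsB_local.lean`, md5 5b269e9f, 260 lines);
landed by the gen-5 packager in gate run 18 as `HodgeCM/PerL34/CharsB_local.lean` (verbatim).
-/
/-
Origin: HOME/pub-hodgecm-pv12/lean/HodgeCM/PerL34/CharsB_local.lean — session planner-pub-hodgecm-pv12-0
(unit pub-hodgecm-pv12, DAG-node prover #12), LEMMAS.md node **N31a** (claimed 2026-08-18T03:22Z).
Intended final place: `HodgeCM/PerL34/CharsB_local.lean`.  Imports Mathlib only; asserts nothing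
(every published input is a named `def … : Prop` consumed as an explicit hypothesis; no axioms beyond the
standard trio).  The carver's `_statement` stub for N31a was not yet published when this was written: the node
is typed here VERBATIM from the tex block (LEMMAS.md §5 N31a = PerL v5 ll. 542–547) over a posited local
data structure (LEMMAS.md §3 D4: the package has no local Weil representation), as LEMMAS.md §0 instructs.
-/
import Mathlib.Order.Lattice.Nat
import Mathlib.Tactic

set_option autoImplicit false

/-!
# N31a — PerL v5 Lemma 4.2(b), proof step "Local non-vanishing" (local occurrence), tex ll. 542–547

**The node, verbatim** (PerL v5 = `HOME/inputs/2001/summits__hodge-w-picard-modular-quadrilinear-period-galois-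
closure__free__y1__paper__paper.tex`, blob d912a121, ll. 542–547):

> (b) Local non-vanishing: at the real places $\theta_b(\chi'_{i,b})$ is $J^+$ resp. $\mathbf 1$ by the choice of
> $e(\Psi_i)$ (Lemma~\ref{lem:arch}(a), i.e. \cite[Lemmas 3.1, 3.2]{Y1neg}); at a finite place $v$, every
> character of $\U(W_{i,v})$ has a non-zero theta lift to $\U(V_{3,v})$: for the pair $(\U(1),\U(3))$ the
> conservation relation $n^+(\chi_v)+n^-(\chi_v)=4$ with $n^\pm$ odd (\cite[Thm.~1.10]{SZ}, all residue
> characteristics; \cite{HKS}) forces first occurrence $\le3$ in both Witt towers, i.e. $\chi'_{i,v}$ occurs in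
> the restriction of $\omega_v$ to the compact group $\U(W_{i,v})$ (at split $v$ the pair is $(\GL_1,\GL_3)$ and
> every character occurs).

**What is proved here (kind L2 = HONEST SPLIT, every input labelled).**  The node has three clauses, one per kind
of place of `L₀`:

* (R) real places `b` — this clause is the CONTENT of Lemma 4.1(a) (= LEMMAS.md node **N27**) applied to the
  character `χ'_i` of infinity type `e(Ψ_i)`; it is carried as the input `hN27` (label: NODE N27), N31a adds
  nothing to it.
* (N) finite places `v` of `L₀` NOT split in `L` — the heart of the node.  KERNEL-PROVED below
  (`NonsplitPlaceThetaData.occurs_dim_three`) from three PUBLISHED inputs quoted verbatim from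
  **[SZ] = B. Sun, C.-B. Zhu, *Conservation relations for local theta correspondence*, J. Amer. Math. Soc. 28
  (2015), no. 4, 939–983** (doi:10.1090/S0894-0347-2014-00817-1; = arXiv:1204.2969v3, held as
  `paper:arxiv-1204.2969`), §1.5 and Theorem 1.10:
    - `Conservation` = [SZ] **Theorem 1.10** (§1.5; arXiv v3 p. 6): "Let t₁ and t₂ be two Witt towers in 𝒲_U
      with difference t°_U. Then for any π ∈ Irr(Ḡ(U)) which is genuine with respect to t₁ (and hence genuine
      with respect to t₂), one has that n_{t₁}(π) + n_{t₂}(π) = 2 dim U + d_{D,ε}."  Here `U = W_{i,v}` is a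
      hermitian LINE over the quadratic extension `D = L_w` of `k = L_{0,v}` (`dim U = 1`), `d_{D,ε} = 2` ("if V
      is a Hermitian space or a skew-Hermitian space", [SZ] (5), §1.3), so the right-hand side is `4`; genuineness
      is an empty condition for unitary groups ([SZ] §1.5, the only condition listed is for symplectic `U`); the
      first occurrence index is `n_t(π) := min{dim σ ∣ σ ∈ t, π ∈ 𝓡_σ}`, `𝓡_σ := {π ∈ Irr(Ḡ(U)) ∣ Hom_{Ḡ(U)}(ω, π)
      ≠ 0}` ([SZ] §1.5, (7)).  PerL's "n^± odd": a Witt tower is `t = {σ_t, σ_t + ℍ_U, σ_t + 2ℍ_U, ⋯}` ([SZ] after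
      Def. 1.9), the tower of `V_{3,v}` has odd dimensions, and so has its partner (`deg t₁ + deg t₂ = d_{D,ε} = 2`,
      [SZ] Prop. 1.7) — so both towers are `{1, 3, 5, …}`; this is built into the indexation `dim = 2r+1` below.
    - `Persistence` = [SZ] §1.5, second bullet: "Kudla's persistence principle ([Ku1]): for all σ₁, σ₂ ∈ t, if
      dim σ₁ ≤ dim σ₂, then 𝓡_{σ₁} ⊂ 𝓡_{σ₂}."  ([Ku1] = S. Kudla, On the local theta correspondence, Invent. Math.
      83 (1986) 229–255.)
    - `FiniteFirstOcc` = [SZ] §1.5: "In view of the aforementioned two properties, the first occurrence index is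
      finite" (the first property being occurrence in the stable range, [SZ] §1.5 first bullet, [Li1]).
  REMARK (redundancy, not a gap): [SZ] §1.5 first bullet ("for all σ ∈ t, if rank σ ≥ dim U, then π ∈ 𝓡_σ")
  already gives clause (N) outright, since `rank V_{3,v} ≥ 1 = dim W_{i,v}` at a non-split finite place
  (a 3-dimensional hermitian space over a p-adic field is isotropic); PerL's route through Theorem 1.10 is the one
  checked here.
* (S) finite places split in `L` — "the pair is (GL₁,GL₃) and every character occurs": PerL gives no citation; it
  is **[Mín] = A. Mínguez, *Correspondance de Howe explicite : paires duales de type II*, Ann. Sci. Éc. Norm.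
  Supér. (4) 41 (2008), 717–741, Théorème 1, part 2 (p. 718)**: "Supposons n ≤ m. Alors Hom_{G_n}(ω_{n,m}, π) ≠ 0"
  for every irreducible smooth `π` of `G_n = GL_n(D)` (all residue characteristics), with `n = 1`, `m = 3`,
  `D = F = L_{0,v}`; carried as the input `hMinguez` (label: PRINT), which IS clause (S).  (Downstream, PerL
  l. 617 uses local occurrence only at NON-split places; at split places Lemma 4.2(b) uses the explicit ball
  function, node N31f.)

So `N31a_statement` is closed MODULO: node N27 (clause R), [SZ] Thm 1.10 + §1.5 (clause N, the implication
kernel-checked here), [Mín] Thm 1(2) (clause S).  Nothing of PerL / [Y1neg] / QW8 / the 2001 programme is used.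
-/

namespace HodgeCM

namespace PerL34

namespace N31a

/-! ## Data at one finite place of `L₀` that does not split in `L` -/

/-- **DATA (posited interface; LEMMAS.md §3 D4).**  The local theta-dichotomy data at ONE finite place `v` of
`L₀` that does NOT split in `L` (so `L_w/L_{0,v}` is a quadratic extension of non-archimedean local fields of
characteristic `0`, and `U(W_{i,v})(L_{0,v}) = L_w^1` is compact), for PerL's hermitian line `W_{i,v}` with its
fixed splitting data (`μ_i`, [SZ]'s "enhanced oscillator representations", §1.4):
* `X` — the irreducible smooth representations of the compact group `U(W_{i,v})(L_{0,v})`, i.e. its characters;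
* `Occurs ε r χ` — "`χ ∈ 𝓡_σ`", i.e. `Hom_{U(W_{i,v})}(ω_σ, χ) ≠ 0` ([SZ] §1.5), for the member `σ` of DIMENSION
  `2r+1` of the odd Witt tower `t_ε` (`ε = signV3`: the tower `{σ_t, σ_t + ℍ_U, …}` containing PerL's `ω_v` on
  `𝒮((V₃ ⊗ W_i)(L_{0,v}))`, [SZ] Def. 1.9; `ε = !signV3`: the tower `t₂ = t₁ − t°_U` of [SZ] Thm 1.10, also of
  odd dimensions by [SZ] Prop. 1.7).  For compact `U(W_{i,v})` "`Hom(ω_σ, χ) ≠ 0`" is the same as "`χ` occurs in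
  the restriction of `ω_σ` to `U(W_{i,v})`" (smooth representations of a compact group are semisimple) — PerL's
  wording at l. 546;
* `signV3` — the tower of the given `3`-dimensional `V_{3,v} = V₃ ⊗ L_w`, so that `Occurs signV3 1 χ` reads
  "`χ` has a non-zero theta lift to `U(V_{3,v})`".
Nothing is asserted about the data. -/
structure NonsplitPlaceThetaData where
  /-- characters of the compact group `U(W_{i,v})(L_{0,v})` -/
  X : Type
  /-- `Occurs ε r χ`: `χ ∈ 𝓡_σ` for the member of dimension `2r+1` of the odd Witt tower `t_ε` -/
  Occurs : Bool → ℕ → X → Prop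
  /-- the tower containing `V_{3,v}` (with PerL's splitting) -/
  signV3 : Bool

namespace NonsplitPlaceThetaData

variable (D : NonsplitPlaceThetaData)

/-- The set of dimensions at which `χ` occurs in the tower `t_ε`: `{dim σ ∣ σ ∈ t_ε, χ ∈ 𝓡_σ}` ([SZ] (7)). -/
def occDims (ε : Bool) (χ : D.X) : Set ℕ :=
  {m : ℕ | ∃ r : ℕ, m = 2 * r + 1 ∧ D.Occurs ε r χ}

/-- **[SZ] §1.5 (7), verbatim:** "Define the first occurrence index
`n_t(π) := min{dim σ ∣ σ ∈ t, π ∈ 𝓡_σ}`."  (`sInf ∅ = 0` in `ℕ`; the empty case is excluded by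
`FiniteFirstOcc`, as in [SZ]: "the first occurrence index is finite".) -/
noncomputable def firstOcc (ε : Bool) (χ : D.X) : ℕ :=
  sInf (D.occDims ε χ)

/-- **PRINT, [SZ] §1.5 (finiteness of the first occurrence index), verbatim:** "In view of the aforementioned two
properties, the first occurrence index is finite" — i.e. every `χ` occurs somewhere in each tower (by occurrence
in the stable range, [SZ] §1.5 first bullet: "for all σ ∈ t, if rank σ ≥ dim U, then π ∈ 𝓡_σ", [Li1]). -/
def FiniteFirstOcc : Prop :=
  ∀ (ε : Bool) (χ : D.X), ∃ r : ℕ, D.Occurs ε r χ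

/-- **PRINT, [SZ] §1.5 second bullet, verbatim:** "Kudla's persistence principle ([Ku1]): for all σ₁, σ₂ ∈ t, if
dim σ₁ ≤ dim σ₂, then 𝓡_{σ₁} ⊂ 𝓡_{σ₂}."  (Within one tower `dim σ₁ ≤ dim σ₂` iff `r₁ ≤ r₂`.) -/
def Persistence : Prop :=
  ∀ (ε : Bool) (χ : D.X) (r₁ r₂ : ℕ), r₁ ≤ r₂ → D.Occurs ε r₁ χ → D.Occurs ε r₂ χ

/-- **PRINT, [SZ] Theorem 1.10 (J. Amer. Math. Soc. 28 (2015) 939–983, §1.5; arXiv:1204.2969v3 p. 6),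
verbatim:** "Let t₁ and t₂ be two Witt towers in 𝒲_U with difference t°_U. Then for any π ∈ Irr(Ḡ(U)) which is
genuine with respect to t₁ (and hence genuine with respect to t₂), one has that
n_{t₁}(π) + n_{t₂}(π) = 2 dim U + d_{D,ε}."  Specialised to `U = W_{i,v}` (`dim U = 1`), `D = L_w` a quadratic
extension (`d_{D,ε} = 2`, [SZ] (5)): `n_{t₁}(χ) + n_{t₂}(χ) = 4` — PerL l. 545 "the conservation relation
n⁺(χ_v) + n⁻(χ_v) = 4". -/
def Conservation : Prop :=
  ∀ χ : D.X, D.firstOcc true χ + D.firstOcc false χ = 4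

variable {D}

/-- The first occurrence index is attained: `n_{t_ε}(χ) = 2r+1` with `χ ∈ 𝓡_{σ_{2r+1}}`. -/
theorem firstOcc_mem (hfin : D.FiniteFirstOcc) (ε : Bool) (χ : D.X) :
    ∃ r : ℕ, D.firstOcc ε χ = 2 * r + 1 ∧ D.Occurs ε r χ := by
  obtain ⟨r, hr⟩ := hfin ε χ
  have hne : (D.occDims ε χ).Nonempty := ⟨2 * r + 1, r, rfl, hr⟩
  exact Nat.sInf_mem hne

/-- The two towers of [SZ] Thm 1.10 in the `Bool` indexation: `n_{t_ε} + n_{t_{!ε}} = 4` for either `ε`. -/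
theorem firstOcc_add_firstOcc_not (hcons : D.Conservation) (ε : Bool) (χ : D.X) :
    D.firstOcc ε χ + D.firstOcc (!ε) χ = 4 := by
  cases ε
  · simpa [add_comm] using hcons χ
  · simpa using hcons χ

/-- **Clause (N) of N31a, kernel-checked (PerL v5 ll. 544–547):** at a finite place of `L₀` not split in `L`,
the conservation relation `n⁺(χ) + n⁻(χ) = 4` with `n^±` odd "forces first occurrence ≤ 3 in both Witt towers",
hence (persistence) every character `χ` of `U(W_{i,v})` occurs at dimension `3` in BOTH towers — in particular
`χ` has a non-zero theta lift to `U(V_{3,v})`, i.e. occurs in the restriction of `ω_v` to the compact group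
`U(W_{i,v})`.  Inputs: `FiniteFirstOcc`, `Persistence`, `Conservation` (all PRINT, [SZ]). -/
theorem occurs_dim_three (hfin : D.FiniteFirstOcc) (hper : D.Persistence) (hcons : D.Conservation)
    (ε : Bool) (χ : D.X) : D.Occurs ε 1 χ := by
  obtain ⟨r, hr, hocc⟩ := firstOcc_mem hfin ε χ
  obtain ⟨r', hr', -⟩ := firstOcc_mem hfin (!ε) χ
  have hsum := firstOcc_add_firstOcc_not hcons ε χ
  -- `(2r+1) + (2r'+1) = 4` forces `r ≤ 1`, i.e. first occurrence `≤ 3`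
  have hr1 : r ≤ 1 := by omega
  exact hper ε χ r 1 hr1 hocc

/-- The same, read off for the given space `V_{3,v}`: every character of `U(W_{i,v})` has a non-zero theta lift
to `U(V_{3,v})` (PerL l. 544). -/
theorem occurs_V3 (hfin : D.FiniteFirstOcc) (hper : D.Persistence) (hcons : D.Conservation) (χ : D.X) :
    D.Occurs D.signV3 1 χ :=
  occurs_dim_three hfin hper hcons D.signV3 χ

/-- PerL's intermediate assertion "first occurrence ≤ 3 in both Witt towers" (l. 546), as stated. -/
theorem firstOcc_le_three (hfin : D.FiniteFirstOcc) (hcons : D.Conservation) (ε : Bool) (χ : D.X) :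
    D.firstOcc ε χ ≤ 3 := by
  obtain ⟨r, hr, -⟩ := firstOcc_mem hfin ε χ
  obtain ⟨r', hr', -⟩ := firstOcc_mem hfin (!ε) χ
  have hsum := firstOcc_add_firstOcc_not hcons ε χ
  omega

/-- … and "with n^± odd" (l. 545). -/
theorem firstOcc_odd (hfin : D.FiniteFirstOcc) (ε : Bool) (χ : D.X) : Odd (D.firstOcc ε χ) := by
  obtain ⟨r, hr, -⟩ := firstOcc_mem hfin ε χ
  exact ⟨r, hr⟩

end NonsplitPlaceThetaData

/-! ## The node over all places of `L₀` -/

/-- **DATA (posited interface).**  The places of `L₀` sorted into the three kinds of ll. 542–547 with the local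
data the clauses speak about:
* `RealPlace` and, for each real `b`, the proposition `RealClause b` := "`θ_b(χ'_{i,b})` is `J⁺` (at `b = ι₁`)
  resp. `𝟏` (at `b ≠ ι₁`)" — the archimedean theta lift of the `b`-component of PerL's `χ'_i` of infinity type
  `e(Ψ_i)`; its truth is Lemma 4.1(a) = node N27 (not re-typed here: N27 owns the Fock-model vocabulary, LEMMAS.md
  §3 D5);
* `NonsplitPlace` with `nonsplit v : NonsplitPlaceThetaData` (above);
* `SplitPlace` and, for each split `v`, the characters `Xsplit v` of `U(W_{i,v})(L_{0,v}) = GL₁(L_{0,v})` and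
  `OccursSplit v χ` := `Hom_{GL₁}(ω_{1,3}, χ) ≠ 0` for the type II pair `(GL₁, GL₃)` realised on
  `𝒮(M_{1×3}(L_{0,v}))` ([Mín] (1.4)), i.e. "`χ` occurs" (PerL l. 547). -/
structure LocalOccurrenceData where
  RealPlace : Type
  RealClause : RealPlace → Prop
  NonsplitPlace : Type
  nonsplit : NonsplitPlace → NonsplitPlaceThetaData
  SplitPlace : Type
  Xsplit : SplitPlace → Type
  OccursSplit : ∀ v : SplitPlace, Xsplit v → Prop

namespace LocalOccurrenceData

variable (D : LocalOccurrenceData)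

/-- **N31a_statement — PerL v5 ll. 542–547 typed verbatim, clause by clause:**
(R) at every real place `θ_b(χ'_{i,b})` is `J⁺` resp. `𝟏`;
(N) at every finite place of `L₀` not split in `L`, EVERY character `χ` of `U(W_{i,v})` has a non-zero theta
    lift to `U(V_{3,v})` ("occurs in the restriction of `ω_v` to the compact group `U(W_{i,v})`"), indeed
    occurs at dimension `3` in both Witt towers ("first occurrence ≤ 3 in both Witt towers");
(S) at every split place every character of `GL₁(L_{0,v})` occurs for the pair `(GL₁, GL₃)`. -/
def N31a_statement : Prop :=
  (∀ b : D.RealPlace, D.RealClause b) ∧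
  (∀ (v : D.NonsplitPlace) (ε : Bool) (χ : (D.nonsplit v).X), (D.nonsplit v).Occurs ε 1 χ) ∧
  (∀ (v : D.SplitPlace) (χ : D.Xsplit v), D.OccursSplit v χ)

/-- **PRINT, [Mín] Théorème 1, part 2 (Ann. Sci. ÉNS 41 (2008), p. 718), verbatim:** "Supposons n ≤ m. Alors
Hom_{G_n}(ω_{n,m}, π) ≠ 0 [et, si π est le quotient de Langlands …]" for every "représentation lisse irréductible
π de G_n", `G_n = GL_n(D)`; here `n = 1 ≤ m = 3`, `D = L_{0,v}`: every character of `GL₁(L_{0,v})` occurs in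
`ω_{1,3}` — PerL l. 547 "(at split v the pair is (GL₁,GL₃) and every character occurs)". -/
def MinguezTypeII : Prop :=
  ∀ (v : D.SplitPlace) (χ : D.Xsplit v), D.OccursSplit v χ

/-- **Clause (R) as an input = node N27** (Lemma 4.1(a), PerL ll. 480–482 / 493–496, applied to `χ'_i` of
infinity type `e(Ψ_i)`): "at the real places `θ_b(χ'_{i,b})` is `J⁺` resp. `𝟏` by the choice of `e(Ψ_i)`". -/
def RealClausesN27 : Prop :=
  ∀ b : D.RealPlace, D.RealClause b

/-- **N31a closed modulo PUBLISHED citations and node N27 (kind L2, honest split):**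
`N27 → [SZ §1.5 finiteness] → [SZ §1.5 persistence] → [SZ Thm 1.10] → [Mín Thm 1(2)] → N31a_statement`,
the implication kernel-checked (the content being PerL's first-occurrence bookkeeping at the non-split places,
`NonsplitPlaceThetaData.occurs_dim_three`). -/
theorem N31a_of_published
    (hN27 : D.RealClausesN27)
    (hSZfin : ∀ v : D.NonsplitPlace, (D.nonsplit v).FiniteFirstOcc)
    (hSZper : ∀ v : D.NonsplitPlace, (D.nonsplit v).Persistence)
    (hSZ110 : ∀ v : D.NonsplitPlace, (D.nonsplit v).Conservation)
    (hMinguez : D.MinguezTypeII) :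
    D.N31a_statement :=
  ⟨hN27, fun v ε χ => NonsplitPlaceThetaData.occurs_dim_three (hSZfin v) (hSZper v) (hSZ110 v) ε χ, hMinguez⟩

/-- What node N31f (local factors, PerL ll. 613–617: "at a non-split finite `v` every character occurs (local
occurrence proved above)") consumes from N31a: occurrence of a GIVEN character (there: `χ̄'_{i,v}`) in `ω_v` on
`V_{3,v}` at a non-split finite place. -/
theorem nonsplit_occurs_V3 {D : LocalOccurrenceData} (h : D.N31a_statement) (v : D.NonsplitPlace)
    (χ : (D.nonsplit v).X) : (D.nonsplit v).Occurs (D.nonsplit v).signV3 1 χ :=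
  h.2.1 v _ χ

end LocalOccurrenceData

end N31a

end PerL34

end HodgeCM
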